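import Literature.AlgebraicGeometry.Frobenioids.Thm49Assembly
import Literature.AlgebraicGeometry.Frobenioids.Thm49CompatOfFunctor
import Literature.AlgebraicGeometry.Frobenioids.PadicFrobenioidFrobeniusCompact
import Literature.AlgebraicGeometry.Frobenioids.PadicFrobenioidStandardType
import Literature.AlgebraicGeometry.Frobenioids.PadicFrobenioidIsotropic
import Literature.AlgebraicGeometry.Frobenioids.PadicFrobenioidCZeroGalois
import Literature.AlgebraicGeometry.Frobenioids.ModelFrobenioidTypeBridge
import Literature.AnabelianGeometry.EtaleTheta.MonoprimeStructure
import HarnessLib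

/-!
# Frobenioids I, Theorem 4.9 at the `p`-adic Frobenioids of [FrdII] Example 1.1 — hypothesis-free over bases
# of FSM-type, and at THE printed `C₀` (non-vacuity row NV-L1 «[FrdI] Thm. 4.9 closers INHABITED», local case)

Mochizuki, *The geometry of Frobenioids I: the general theory*, Kyushu J. Math. **62** (2008) 293–400,
Theorem 4.9 p. 88 (category-theoreticity of the divisor monoid) [cite: MochizukiFrdI2008, Thm. 4.9 p.88], applied
at Mochizuki, *The geometry of Frobenioids II: poly-Frobenioids*, Kyushu J. Math. **62** (2008) 401–460,
Example 1.1 (ii) p. 8 (the `p`-adic Frobenioid `C` of a datum `(D → D₀, Φ ⊆ Φ₀|_D, B → Φ^gp)`) and Theorem 1.2 (i)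
p. 9 ("`C` is a Frobenioid of isotropic, rationally standard type, but not of group-like type")
[cite: MochizukiFrdII2008, Ex 1.1 (ii) p.8] [cite: MochizukiFrdII2008, Thm 1.2 (i) p.9].

PROOF-ONLY file (node FrdI:Thm4.9, genuine-data instance at the LOCAL Frobenioids; seat abc-iut-w4-d109, T49-L00
lineage; companion of `Thm49Arithmetic.lean`), 0 definitions. For `p`-adic Frobenioid data `d_i : PadicFrd.Datum
D_i p_i` over connected, totally epimorphic bases `D_i` OF FSM-TYPE (e.g. THE base `D₀ = B(G_{ℚ_p})⁰` of Ex. 1.1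
(i), `PadicFrd.dZero_isOfFSMType`; or `B^temp(Π, Π°)⁰` of Ex. 1.3 (i)), every hypothesis of the cell's Thm. 4.9
closers `FrdI.T49.thm49_ofFunctor_of_isOfFSMType` (seat abc-iut-w4-d109) and
`FrdI.T49.exists_thm49_compat_ofFunctor_of_isOfFSMType'` (seat abc-iut-w4-d105) is a theorem of the tree:

* `C` is a Frobenioid (Ex. 1.1 (ii) via [FrdI] Thm. 5.2 (ii); `PadicFrd.Datum.isFrobenioid_of_isOfFSMType`, seats
  abc-iut-L1-d8/d10 — the monoid-data premise automatic over an FSM-type base);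
* `Φ` is perf-factorial objectwise (each `Φ(A)` is monoprime, Ex. 1.1 (i)/(ii); `MonoprimeStructure.isPerfFactorial`,
  seat abc-iut-L2);
* `C` is of rationally standard type at THE Def. 4.5 (iii) parameters (Thm. 1.2 (i);
  `PadicFrd.Datum.isOfRationallyStandardType_rsParams_of_isOfFSMType`, seat abc-iut-L1-d10 lineage) — its
  "rational" conjunct is the closers' binder `hrat₁`;
* `C` is of standard and isotropic type and not of group-like type (Thm. 1.2 (i);
  `thm12_isOfStandardType_of_isOfFSMType`, `thm12_isOfIsotropicType`, `thm12_not_isGroupLike`).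

Hence, with no hypothesis beyond "`D_i` of FSM-type": for EVERY equivalence `Ψ : C₁ ⥲ C₂` between two such
`p`-adic Frobenioids (the primes `p₁`, `p₂` and the data arbitrary) there is an isomorphism of functors
`Ψ^Φ : Φ₁ ⥲ Φ₂` lying over `Ψ` (`PadicFrd.nonempty_divisorMonoidIsoOver_padic`), the typed `Thm49` holds at any
parameters (`PadicFrd.thm49_padic_rsParams`), and the compatibility clause `Thm49_compat` is inhabited
(`PadicFrd.exists_thm49_compat_padic`); at THE printed `C₀` of Ex. 1.1 (i) (`PadicFrd.CZeroGal p`) nothing at all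
is assumed (`PadicFrd.nonempty_divisorMonoidIsoOver_czeroGal`). No statement of either paper is restated or
strengthened; nothing here bears on, or takes a side on, [IUTchIII] Cor. 3.12.
-/

noncomputable section

namespace Literature.AlgebraicGeometry.Frobenioids

open CategoryTheory Opposite
open PreFrobenioid PreFrobenioidData

namespace PadicFrd

universe v u

section TwoData

variable {D₁ : Type u} [Category.{v} D₁] {D₂ : Type u} [Category.{v} D₂]
variable {p₁ p₂ : ℕ} [Fact p₁.Prime] [Fact p₂.Prime]
variable (d₁ : Datum D₁ p₁) (d₂ : Datum D₂ p₂)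

/-! ### The hypotheses of the Thm. 4.9 closers at a `p`-adic Frobenioid -/

/-- "`Φ₀` … perf-factorial" / "monoprime … subfunctor in monoids" ([FrdII] Ex. 1.1 (i)/(ii) pp. 7–8): the divisor
monoid of a `p`-adic Frobenioid datum is perf-factorial objectwise (each `Φ(A)` is monoprime; seat abc-iut-L2's
`MonoprimeStructure.isPerfFactorial`), in the `Objectwise` form the Thm. 4.9 closers consume, at any universe.
[cite: MochizukiFrdII2008, Ex 1.1 (i) p.7] -/
theorem padic_objectwise_isPerfFactorial :
    Objectwise (fun M _ => IsPerfFactorial M) d₁.Φ :=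
  fun _ => Literature.AnabelianGeometry.EtaleTheta.MonoprimeStructure.isPerfFactorial (d₁.isMonoprime _)

/-- **"`C` is of rational type" READ AT THE CONSTRUCTIONS** for a `p`-adic Frobenioid over a base of FSM-type —
the binder `hrat₁` of the cell's Thm. 4.9 closers: every object is rational ([FrdI] Def. 4.5 (ii)) at THE
birationalization and the primary support of Def. 2.4 (i)(d); it is the "rational" conjunct of [FrdII] Thm. 1.2
(i) at THE parameters (`isOfRationallyStandardType_rsParams_of_isOfFSMType`). [cite: MochizukiFrdII2008, Thm 1.2 (i) p.9] -/
theorem padic_isRational_biratData (hD₁ : IsOfFSMType D₁) (A : d₁.frobenioid) :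
    PreFrobenioidData.IsRational
      (biratData (d₁.isFrobenioid_of_isMonoidData (d₁.isMonoidData_of_isOfFSMType hD₁))
        (hasBiratSquares_of_isFrobenioid
          (d₁.isFrobenioid_of_isMonoidData (d₁.isMonoidData_of_isOfFSMType hD₁))))
      (S := ModelFrobenioid.data d₁.Φ d₁.B d₁.divB) (fun a 𝔭 => PrimarySupp a 𝔭) A :=
  (d₁.isOfRationallyStandardType_rsParams_of_isOfFSMType hD₁).rational A

/-- The `p`-adic Frobenioid is not of group-like type, in seat abc-iut-L1-t3's operations language ([FrdII]
Thm. 1.2 (i) "but not of group-like type"; `thm12_not_isGroupLike`). [cite: MochizukiFrdII2008, Thm 1.2 (i) p.9] -/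
theorem padic_not_isOfGroupLikeType :
    ¬ (ModelFrobenioid.data d₁.Φ d₁.B d₁.divB).IsOfGroupLikeType := fun h =>
  d₁.thm12_not_isGroupLike fun X => (ofFunctor_isGroupLikeObj d₁.structureFunctor X).mp (h.obj X)

/-- The hypotheses of the compatibility clause of Thm. 4.9 (`Thm42Setting`: standard type, isotropic type, not of
group-like type) HOLD for every pair of `p`-adic Frobenioids over bases of FSM-type ([FrdII] Thm. 1.2 (i)).
[cite: MochizukiFrdII2008, Thm 1.2 (i) p.9] -/
theorem thm42Setting_padic (hD₁ : IsOfFSMType D₁) (hD₂ : IsOfFSMType D₂) :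
    Thm42Setting (ModelFrobenioid.data d₁.Φ d₁.B d₁.divB) (ModelFrobenioid.data d₂.Φ d₂.B d₂.divB) where
  standard := ⟨d₁.thm12_isOfStandardType_of_isOfFSMType hD₁, d₂.thm12_isOfStandardType_of_isOfFSMType hD₂⟩
  isotropic := ⟨ModelFrobenioid.data_isOfIsotropicType d₁.objectwise_isGroupLike_B,
    ModelFrobenioid.data_isOfIsotropicType d₂.objectwise_isGroupLike_B⟩
  notGroupLike := ⟨padic_not_isOfGroupLikeType d₁, padic_not_isOfGroupLikeType d₂⟩

/-! ### Theorem 4.9 at the `p`-adic Frobenioids over bases of FSM-type -/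

/-- **[FrdI] Thm. 4.9 AS TYPED (`PreFrobenioidData.Thm49`) for a pair of `p`-adic Frobenioids over bases of
FSM-type, any equivalence `Ψ` between them and ANY Def. 4.5 (iii) parameters `R₁, R₂`** — no further input.
[cite: MochizukiFrdI2008, Thm. 4.9 p.88] -/
theorem thm49_padic_rsParams (hD₁ : IsOfFSMType D₁) (hD₂ : IsOfFSMType D₂)
    (Ψ : d₁.frobenioid ≌ d₂.frobenioid)
    (R₁ : (ModelFrobenioid.data d₁.Φ d₁.B d₁.divB).RSParams)
    (R₂ : (ModelFrobenioid.data d₂.Φ d₂.B d₂.divB).RSParams) :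
    (ModelFrobenioid.data d₁.Φ d₁.B d₁.divB).Thm49 (ModelFrobenioid.data d₂.Φ d₂.B d₂.divB) Ψ R₁ R₂ :=
  FrdI.T49.thm49_ofFunctor_of_isOfFSMType
    (d₁.isFrobenioid_of_isMonoidData (d₁.isMonoidData_of_isOfFSMType hD₁))
    (d₂.isFrobenioid_of_isMonoidData (d₂.isMonoidData_of_isOfFSMType hD₂)) hD₁ hD₂
    (padic_objectwise_isPerfFactorial d₁) (padic_objectwise_isPerfFactorial d₂)
    (padic_isRational_biratData d₁ hD₁) Ψ R₁ R₂

/-- **[FrdI] Thm. 4.9 AS TYPED at THE Def. 4.5 (iii) parameters** of the two `p`-adic Frobenioids (support =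
the primary support of Def. 2.4 (i)(d)). [cite: MochizukiFrdI2008, Thm. 4.9 p.88] -/
theorem thm49_padic (hD₁ : IsOfFSMType D₁) (hD₂ : IsOfFSMType D₂) (Ψ : d₁.frobenioid ≌ d₂.frobenioid) :
    (ModelFrobenioid.data d₁.Φ d₁.B d₁.divB).Thm49 (ModelFrobenioid.data d₂.Φ d₂.B d₂.divB) Ψ
      (rsParams (d₁.isFrobenioid_of_isMonoidData (d₁.isMonoidData_of_isOfFSMType hD₁))
        fun a 𝔭 => PrimarySupp a 𝔭)
      (rsParams (d₂.isFrobenioid_of_isMonoidData (d₂.isMonoidData_of_isOfFSMType hD₂))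
        fun a 𝔭 => PrimarySupp a 𝔭) :=
  thm49_padic_rsParams d₁ d₂ hD₁ hD₂ Ψ _ _

/-- **The conclusion of [FrdI] Thm. 4.9 at the `p`-adic Frobenioids, hypothesis-free over bases of FSM-type**:
for EVERY equivalence of categories `Ψ : C₁ ⥲ C₂` between `p`-adic Frobenioids there is an isomorphism of
functors `Ψ^Φ : Φ₁ ⥲ Φ₂` lying over `Ψ` — monoid isomorphisms `Φ₁(Base A) ≃* Φ₂(Base Ψ(A))` natural in `A`
(the antecedents "`C_i` of rationally standard type" being [FrdII] Thm. 1.2 (i) at THE parameters).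
[cite: MochizukiFrdI2008, Thm. 4.9 p.88] -/
theorem nonempty_divisorMonoidIsoOver_padic (hD₁ : IsOfFSMType D₁) (hD₂ : IsOfFSMType D₂)
    (Ψ : d₁.frobenioid ≌ d₂.frobenioid) :
    Nonempty (DivisorMonoidIsoOver (ModelFrobenioid.data d₁.Φ d₁.B d₁.divB)
      (ModelFrobenioid.data d₂.Φ d₂.B d₂.divB) Ψ) :=
  thm49_padic d₁ d₂ hD₁ hD₂ Ψ (d₁.isOfRationallyStandardType_rsParams_of_isOfFSMType hD₁)
    (d₂.isOfRationallyStandardType_rsParams_of_isOfFSMType hD₂)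

/-- **The typed compatibility clause `Thm49_compat` is inhabited at the `p`-adic Frobenioids over bases of
FSM-type**: for every `Ψ : C₁ ⥲ C₂` there are an isomorphism of functors `Ψ^Φ` over `Ψ` computing
`Div(Ψ φ) = Ψ^Φ_A(Div φ)` on pre-steps and a family of prime bijections (THE `Ψ^Prime` of Thm. 4.2 (ii)) such that
`Ψ^Φ_A` carries `Φ₁(A)_𝔭` onto `Φ₂(Ψ A)_{Ψ^Prime 𝔭}` ([FrdI] Thm. 4.9 p. 89; the `C_i` being isotropic, standard,
non-group-like by [FrdII] Thm. 1.2 (i)). [cite: MochizukiFrdI2008, Thm. 4.9 p.89] -/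
theorem exists_thm49_compat_padic (hD₁ : IsOfFSMType D₁) (hD₂ : IsOfFSMType D₂)
    (Ψ : d₁.frobenioid ≌ d₂.frobenioid) :
    ∃ (E : DivisorMonoidIsoOver (ModelFrobenioid.data d₁.Φ d₁.B d₁.divB)
        (ModelFrobenioid.data d₂.Φ d₂.B d₂.divB) Ψ)
      (e : ∀ A : d₁.frobenioid,
        Primes ((ModelFrobenioid.data d₁.Φ d₁.B d₁.divB).Mon
            ((ModelFrobenioid.data d₁.Φ d₁.B d₁.divB).base.obj A)) ≃
          Primes ((ModelFrobenioid.data d₂.Φ d₂.B d₂.divB).Mon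
            ((ModelFrobenioid.data d₂.Φ d₂.B d₂.divB).base.obj (Ψ.functor.obj A)))),
      (∀ ⦃A B : d₁.frobenioid⦄ (φ : A ⟶ B), IsPreStep d₁.structureFunctor φ →
          E.iso A (Div d₁.structureFunctor φ) = Div d₂.structureFunctor (Ψ.functor.map φ)) ∧
      (ModelFrobenioid.data d₁.Φ d₁.B d₁.divB).Thm49_compat (ModelFrobenioid.data d₂.Φ d₂.B d₂.divB) Ψ E e := by
  obtain ⟨E, e, -, hdiv, h⟩ := FrdI.T49.exists_thm49_compat_ofFunctor_of_isOfFSMType'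
    (d₁.isFrobenioid_of_isMonoidData (d₁.isMonoidData_of_isOfFSMType hD₁))
    (d₂.isFrobenioid_of_isMonoidData (d₂.isMonoidData_of_isOfFSMType hD₂)) hD₁ hD₂
    (padic_objectwise_isPerfFactorial d₁) (padic_objectwise_isPerfFactorial d₂)
    (padic_isRational_biratData d₁ hD₁) Ψ (thm42Setting_padic d₁ d₂ hD₁ hD₂)
  exact ⟨E, e, hdiv, h⟩

end TwoData

/-! ### At THE printed `C₀` of [FrdII] Example 1.1 (i): nothing assumed -/

section CZero

variable (p₁ p₂ : ℕ) [Fact p₁.Prime] [Fact p₂.Prime]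

/-- **[FrdI] Thm. 4.9 at THE `p`-adic Frobenioids `C₀` of [FrdII] Ex. 1.1 (i), with NO hypothesis**: for every
equivalence `Ψ : C₀(p₁) ⥲ C₀(p₂)` (over THE bases `D₀ = B(G_{ℚ_{p_i}})⁰`, of FSM-type by
`PadicFrd.dZero_isOfFSMType`) there is an isomorphism of functors `Ψ^Φ : Φ₀ ⥲ Φ₀` lying over `Ψ`.
[cite: MochizukiFrdI2008, Thm. 4.9 p.88] [cite: MochizukiFrdII2008, Ex 1.1 (i) p.7] -/
theorem nonempty_divisorMonoidIsoOver_czeroGal (Ψ : CZeroGal p₁ ≌ CZeroGal p₂) :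
    Nonempty (DivisorMonoidIsoOver
      (ModelFrobenioid.data (Datum.zeroGal p₁).Φ (Datum.zeroGal p₁).B (Datum.zeroGal p₁).divB)
      (ModelFrobenioid.data (Datum.zeroGal p₂).Φ (Datum.zeroGal p₂).B (Datum.zeroGal p₂).divB) Ψ) :=
  nonempty_divisorMonoidIsoOver_padic (Datum.zeroGal p₁) (Datum.zeroGal p₂) (dZero_isOfFSMType p₁)
    (dZero_isOfFSMType p₂) Ψ

/-- The same at one prime and a self-equivalence of `C₀` (e.g. the identity; the `refl` instance of the NV
register). [cite: MochizukiFrdI2008, Thm. 4.9 p.88] [cite: MochizukiFrdII2008, Ex 1.1 (i) p.7] -/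
theorem nonempty_divisorMonoidIsoOver_czeroGal_refl :
    Nonempty (DivisorMonoidIsoOver
      (ModelFrobenioid.data (Datum.zeroGal p₁).Φ (Datum.zeroGal p₁).B (Datum.zeroGal p₁).divB)
      (ModelFrobenioid.data (Datum.zeroGal p₁).Φ (Datum.zeroGal p₁).B (Datum.zeroGal p₁).divB)
      (CategoryTheory.Equivalence.refl (C := CZeroGal p₁))) :=
  nonempty_divisorMonoidIsoOver_czeroGal p₁ p₁ _

/-- **The typed `Thm49` and its compatibility clause at THE `C₀`, no hypothesis.**
[cite: MochizukiFrdI2008, Thm. 4.9 p.89] [cite: MochizukiFrdII2008, Ex 1.1 (i) p.7] -/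
theorem exists_thm49_compat_czeroGal (Ψ : CZeroGal p₁ ≌ CZeroGal p₂) :
    ∃ (E : DivisorMonoidIsoOver
        (ModelFrobenioid.data (Datum.zeroGal p₁).Φ (Datum.zeroGal p₁).B (Datum.zeroGal p₁).divB)
        (ModelFrobenioid.data (Datum.zeroGal p₂).Φ (Datum.zeroGal p₂).B (Datum.zeroGal p₂).divB) Ψ)
      (e : ∀ A : CZeroGal p₁,
        Primes ((ModelFrobenioid.data (Datum.zeroGal p₁).Φ (Datum.zeroGal p₁).B (Datum.zeroGal p₁).divB).Mon
            ((ModelFrobenioid.data (Datum.zeroGal p₁).Φ (Datum.zeroGal p₁).B (Datum.zeroGal p₁).divB).base.obj A)) ≃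
          Primes ((ModelFrobenioid.data (Datum.zeroGal p₂).Φ (Datum.zeroGal p₂).B (Datum.zeroGal p₂).divB).Mon
            ((ModelFrobenioid.data (Datum.zeroGal p₂).Φ (Datum.zeroGal p₂).B (Datum.zeroGal p₂).divB).base.obj
              (Ψ.functor.obj A)))),
      (ModelFrobenioid.data (Datum.zeroGal p₁).Φ (Datum.zeroGal p₁).B (Datum.zeroGal p₁).divB).Thm49_compat
        (ModelFrobenioid.data (Datum.zeroGal p₂).Φ (Datum.zeroGal p₂).B (Datum.zeroGal p₂).divB) Ψ E e := by
  obtain ⟨E, e, -, h⟩ := exists_thm49_compat_padic (Datum.zeroGal p₁) (Datum.zeroGal p₂)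
    (dZero_isOfFSMType p₁) (dZero_isOfFSMType p₂) Ψ
  exact ⟨E, e, h⟩

end CZero

end PadicFrd

end Literature.AlgebraicGeometry.Frobenioids

end
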